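import Summits.BirchSwinnertonDyer.Rank1Residual.Supersingular.BlindPointLever
import Mathlib.RingTheory.PowerSeries.Derivative
import HarnessLib

/-!
# `BlindLever.evalAt` is a ring homomorphism; the derivative at a point `BlindLever.derivAt`
# (cell `b2b-bsdres`, O1 sub-cell `p = 2`; cc-typer-4 GEN 7, typer item (27″) "9b as a theorem",
# preliminaries 1/2)

HONEST FRAMING (run/shared/lean/b2b/bsd-rank1-residual/, verbatim in every file): the goal of the
cell is to DELETE the COMBINATION-SHAPED residual classes of the Birch–Swinnerton-Dyer formula for
ALL analytic-rank `≤ 1` elliptic curves over `ℚ` — "full BSD formula for every rank `≤ 1` curve in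
class `C`" assembled STRICTLY from published theorems — so that the rank-`≤ 1` remainder becomes
exactly the CONSTRUCTION-SHAPED classes, which are TYPED (missing-input `Prop`s), NOT attempted.
This is not "finishing BSD". THEOREMS ONLY plus two auxiliary definitions (`BlindLever.evalAtHom`,
the bundled form of the lever's `BlindLever.evalAt`, and `BlindLever.derivAt`, its derivative-at-a-point
companion); `p`-adic bookkeeping on `ℤ_p⟦T⟧`; nothing about any curve is asserted; nothing booked;
no label moves.

CONTENTS. `BlindLever.evalAt t` (`BlindPointLever.lean`: `g ↦ Σ_k g_k t^k` for `‖t‖ < 1`) is a ring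
homomorphism `ℤ_p⟦T⟧ → ℤ_p` (`evalAt_add`, `evalAt_mul` (lever file), `evalAt_one`, `evalAtHom`),
agrees with `Polynomial.eval` on polynomials (`evalAt_coe`, `evalAt_coe_map_intCast`), and
`BlindLever.derivAt t g := (dg/dT)(t)` (Mathlib `PowerSeries.derivative`) is additive, satisfies the
Leibniz rule `(gh)′(t) = g(t)h′(t) + h(t)g′(t)` (`derivAt_mul`) and is `Polynomial.derivative` on
polynomials (`derivAt_coe`, `derivAt_coe_map_intCast`). Used by `BlindPointFlatTwoPrelim.lean` /
`BlindPointFlatTwo.lean` (the blind `♭`-law at `T = −2`). Everything is [folklore]. Folder record: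
`HOME/class-closure/O1/TYPING.md` §10.
-/

set_option autoImplicit false

noncomputable section

open Polynomial

namespace Summit.BirchSwinnertonDyer.Rank1Residual.Supersingular

/-! ## §1. `evalAt` is a ring homomorphism; `derivAt` -/

namespace BlindLever

variable {p : ℕ} [Fact p.Prime]

/-- Values add: `(g + h)(t) = g(t) + h(t)` on the open disc. [folklore] -/
theorem evalAt_add {t : ℤ_[p]} (ht : ‖t‖ < 1) (g h : PowerSeries ℤ_[p]) :
    evalAt t (g + h) = evalAt t g + evalAt t h := by
  unfold evalAt
  rw [← (summable_coeff_mul_pow ht g).tsum_add (summable_coeff_mul_pow ht h)]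
  refine tsum_congr fun k ↦ ?_
  rw [map_add, add_mul]

/-- On polynomials `evalAt` is `Polynomial.eval` (a finite sum). [folklore] -/
theorem evalAt_coe (t : ℤ_[p]) (q : ℤ_[p][X]) :
    evalAt t (q : PowerSeries ℤ_[p]) = q.eval t := by
  unfold evalAt
  rw [tsum_eq_sum (s := Finset.range (q.natDegree + 1)), Polynomial.eval_eq_sum_range]
  · refine Finset.sum_congr rfl fun k _ ↦ ?_
    rw [Polynomial.coeff_coe]
  · intro k hk
    rw [Finset.mem_range, not_lt] at hk
    rw [Polynomial.coeff_coe, Polynomial.coeff_eq_zero_of_natDegree_lt (by omega), zero_mul]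

/-- `evalAt t (C r) = r`. [folklore] -/
theorem evalAt_C (t r : ℤ_[p]) : evalAt t (PowerSeries.C r) = r := by
  rw [← Polynomial.coe_C, evalAt_coe, eval_C]

/-- `evalAt t 1 = 1`. [folklore] -/
theorem evalAt_one (t : ℤ_[p]) : evalAt t (1 : PowerSeries ℤ_[p]) = 1 := by
  rw [← Polynomial.coe_one, evalAt_coe, eval_one]

/-- `evalAt t 0 = 0`. [folklore] -/
theorem evalAt_zero (t : ℤ_[p]) : evalAt t (0 : PowerSeries ℤ_[p]) = 0 := by
  unfold evalAt
  simp

/-- `evalAt t X = t`. [folklore] -/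
theorem evalAt_X (t : ℤ_[p]) : evalAt t (PowerSeries.X : PowerSeries ℤ_[p]) = t := by
  rw [← Polynomial.coe_X, evalAt_coe, eval_X]

/-- **Evaluation at a point of the open unit disc is a ring homomorphism `ℤ_p⟦T⟧ → ℤ_p`.**
[folklore] -/
def evalAtHom {t : ℤ_[p]} (ht : ‖t‖ < 1) : PowerSeries ℤ_[p] →+* ℤ_[p] where
  toFun := evalAt t
  map_one' := evalAt_one t
  map_mul' := evalAt_mul ht
  map_zero' := evalAt_zero t
  map_add' := evalAt_add ht

/-- Unfolding lemma for `evalAtHom`. [folklore] -/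
@[simp] theorem evalAtHom_apply {t : ℤ_[p]} (ht : ‖t‖ < 1) (g : PowerSeries ℤ_[p]) :
    evalAtHom ht g = evalAt t g := rfl

/-- `evalAt t (−g) = −evalAt t g`. [folklore] -/
theorem evalAt_neg {t : ℤ_[p]} (ht : ‖t‖ < 1) (g : PowerSeries ℤ_[p]) :
    evalAt t (-g) = -evalAt t g := by
  rw [← evalAtHom_apply ht, map_neg, evalAtHom_apply]

/-- `evalAt t (g − h) = evalAt t g − evalAt t h`. [folklore] -/
theorem evalAt_sub {t : ℤ_[p]} (ht : ‖t‖ < 1) (g h : PowerSeries ℤ_[p]) :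
    evalAt t (g - h) = evalAt t g - evalAt t h := by
  rw [← evalAtHom_apply ht, map_sub, evalAtHom_apply, evalAtHom_apply]

/-- The value at `t` of an integer polynomial mapped to `ℤ_p⟦T⟧` is the integer value, at an
integer point. [folklore] -/
theorem evalAt_coe_map_intCast (q : ℤ[X]) (i : ℤ) :
    evalAt (i : ℤ_[p]) ((q.map (Int.castRingHom ℤ_[p]) : ℤ_[p][X]) : PowerSeries ℤ_[p]) =
      ((q.eval i : ℤ) : ℤ_[p]) := by
  rw [evalAt_coe, eval_intCast_map, eq_intCast, Int.cast_id]

/-- **The derivative at a point**: `derivAt t g = g′(t) = Σ_k (k+1) g_{k+1} t^k`, the value at `t` of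
the formal derivative `d g/dT` (Mathlib `PowerSeries.derivative`). [folklore] -/
def derivAt (t : ℤ_[p]) (g : PowerSeries ℤ_[p]) : ℤ_[p] :=
  evalAt t (PowerSeries.derivative ℤ_[p] g)

/-- Unfolding lemma for `derivAt`. [folklore] -/
theorem derivAt_def (t : ℤ_[p]) (g : PowerSeries ℤ_[p]) :
    derivAt t g = evalAt t (PowerSeries.derivative ℤ_[p] g) := rfl

/-- `derivAt` is additive. [folklore] -/
theorem derivAt_add {t : ℤ_[p]} (ht : ‖t‖ < 1) (g h : PowerSeries ℤ_[p]) :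
    derivAt t (g + h) = derivAt t g + derivAt t h := by
  rw [derivAt, map_add, evalAt_add ht, derivAt, derivAt]

/-- **Leibniz rule at a point**: `(g h)′(t) = g(t) h′(t) + h(t) g′(t)`. [folklore] -/
theorem derivAt_mul {t : ℤ_[p]} (ht : ‖t‖ < 1) (g h : PowerSeries ℤ_[p]) :
    derivAt t (g * h) = evalAt t g * derivAt t h + evalAt t h * derivAt t g := by
  rw [derivAt, Derivation.leibniz, evalAt_add ht, smul_eq_mul, smul_eq_mul, evalAt_mul ht,
    evalAt_mul ht, derivAt, derivAt]

/-- On polynomials `derivAt` is the value of `Polynomial.derivative`. [folklore] -/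
theorem derivAt_coe (t : ℤ_[p]) (q : ℤ_[p][X]) :
    derivAt t (q : PowerSeries ℤ_[p]) = (derivative q).eval t := by
  rw [derivAt, PowerSeries.derivative_coe, evalAt_coe]

/-- The derivative at an integer point of an integer polynomial mapped to `ℤ_p⟦T⟧`. [folklore] -/
theorem derivAt_coe_map_intCast (q : ℤ[X]) (i : ℤ) :
    derivAt (i : ℤ_[p]) ((q.map (Int.castRingHom ℤ_[p]) : ℤ_[p][X]) : PowerSeries ℤ_[p]) =
      (((derivative q).eval i : ℤ) : ℤ_[p]) := by
  rw [derivAt_coe, Polynomial.derivative_map, eval_intCast_map, eq_intCast, Int.cast_id]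

/-- `‖−2‖₂ = ½ < 1`: the blind point lies in the open unit disc of `ℤ₂`. [folklore] -/
theorem norm_neg_two_lt_one : ‖(-2 : ℤ_[2])‖ < 1 := by
  rw [norm_neg, show (2 : ℤ_[2]) = ((2 : ℕ) : ℤ_[2]) by norm_cast, PadicInt.norm_p]
  norm_num

/-- `−2 ∈ ℤ₂` is the image of the integer `−2`. [folklore] -/
theorem intCast_neg_two : ((-2 : ℤ) : ℤ_[2]) = -2 := by push_cast; rfl

end BlindLever

end Summit.BirchSwinnertonDyer.Rank1Residual.Supersingular

end
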